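import Summits.ResolutionOfSingularities.ResolutionOfSingularities.Theorems.WeightedInvariantPClassDecomposition

/-!
# (F-3) File B — monomial ideals and weight filtrations are `p`-class graded  [OURS · L1 W4.3]

Kernel infrastructure for RE-ENTRY OBJECT #1 of chain w43 (the DOM word at level ≤ 3,
door crux `stmt-ResolutionOfSingularities-19897`), continuing
`WeightedInvariantPClassDecomposition` (file A: `exponentClass`, `pClassComponent`).

For a commutative ring `K` and the power-series ring `K⟦X_σ⟧` we prove:

* the SUPPORT CRITERION for monomial ideals: for a finite set of exponents `A`,
  `f ∈ (X^a : a ∈ A)` iff every exponent in the support of `f` is `≥ a` for some `a ∈ A`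
  (`mem_span_monomial_iff`; the direction `⇒` holds for arbitrary `A`,
  `coeff_eq_zero_of_mem_span_monomial`);
* hence MONOMIAL IDEALS ARE `p`-CLASS GRADED: `f ∈ (X^a : a ∈ A)` iff every class component
  `pClassComponent p κ f` lies in it (`mem_span_monomial_iff_forall_pClassComponent_mem`);
* the WEIGHT FILTRATION is `p`-class graded as well: the weighted order of `f` is the minimum of
  the weighted orders of its class components (`weightedOrder_eq_iInf_pClassComponent`,
  `le_weightedOrder_iff_forall_pClassComponent`).

[OURS · L1 W4.3] replaces the role of the Cohen-structure / `p`-basis bookkeeping in the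
Frobenius-class argument (O70B-JCAN-PLAN §7 (ii), (iii)); NOT a statement of the manuscript.
-/

set_option linter.dupNamespace false

namespace Summit.ResolutionOfSingularities.ResolutionOfSingularities.Theorems.LocalEngine.Iota3.PClass

open MvPowerSeries

variable {σ : Type*} {K : Type*} [CommRing K]

/-! ## The support criterion for monomial ideals -/

/-- In a monomial ideal `(X^a : a ∈ A)` (any set `A` of exponents), the coefficient of an exponent
divisible by no generator vanishes. -/
theorem coeff_eq_zero_of_mem_span_monomial {A : Set (σ →₀ ℕ)} {f : MvPowerSeries σ K}
    (hf : f ∈ Ideal.span ((fun a => monomial a (1 : K)) '' A)) {n : σ →₀ ℕ}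
    (hn : ∀ a ∈ A, ¬ a ≤ n) : coeff n f = 0 := by
  classical
  let J : Ideal (MvPowerSeries σ K) :=
    { carrier := {g | ∀ m : σ →₀ ℕ, (∀ a ∈ A, ¬ a ≤ m) → coeff m g = 0}
      add_mem' := fun {x y} hx hy m hm => by rw [map_add, hx m hm, hy m hm, add_zero]
      zero_mem' := fun m _ => by rw [map_zero]
      smul_mem' := fun c x hx m hm => by
        rw [smul_eq_mul, coeff_mul]
        refine Finset.sum_eq_zero fun ij hij => ?_
        rw [Finset.HasAntidiagonal.mem_antidiagonal] at hij
        rw [hx ij.2 (fun a ha hle => hm a ha (hle.trans (le_add_self.trans_eq hij))), mul_zero] }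
  have hJ : Ideal.span ((fun a => monomial a (1 : K)) '' A) ≤ J := by
    rw [Ideal.span_le]
    rintro _ ⟨a, ha, rfl⟩ m hm
    exact coeff_monomial_ne (fun h => hm a ha (le_of_eq h.symm)) _
  exact hJ hf n hn

/-- A monomial divisible by a generator lies in the monomial ideal. -/
theorem monomial_mem_span_monomial {A : Set (σ →₀ ℕ)} {a b : σ →₀ ℕ} (ha : a ∈ A) (hab : a ≤ b)
    (c : K) : monomial b c ∈ Ideal.span ((fun a => monomial a (1 : K)) '' A) := by
  have h : monomial b c = monomial (b - a) c * monomial a (1 : K) := by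
    rw [monomial_mul_monomial, tsub_add_cancel_of_le hab, mul_one]
  rw [h]
  exact Ideal.mul_mem_left _ _ (Ideal.subset_span ⟨a, ha, rfl⟩)

/-- Converse of `coeff_eq_zero_of_mem_span_monomial` for FINITELY many generators: a series all of
whose exponents are divisible by some generator lies in the monomial ideal. -/
theorem mem_span_monomial_of_coeff (A : Finset (σ →₀ ℕ)) {f : MvPowerSeries σ K}
    (hf : ∀ n, coeff n f ≠ 0 → ∃ a ∈ A, a ≤ n) :
    f ∈ Ideal.span ((fun a => monomial a (1 : K)) '' (A : Set (σ →₀ ℕ))) := by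
  classical
  induction A using Finset.induction_on generalizing f with
  | empty =>
    have h0 : f = 0 := by
      ext n
      rw [map_zero]
      by_contra h
      obtain ⟨a, ha, -⟩ := hf n h
      simp at ha
    rw [h0]
    exact zero_mem _
  | insert a A _haA ih =>
    -- split off the part of `f` divisible by `X^a`
    let g : MvPowerSeries σ K := fun m => coeff (m + a) f
    have hg : ∀ m, coeff m g = coeff (m + a) f := fun m => rfl
    have h1 : ∀ n, a ≤ n → coeff n (monomial a (1 : K) * g) = coeff n f := fun n h => by
      rw [coeff_monomial_mul, if_pos h, one_mul, hg, tsub_add_cancel_of_le h]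
    have h2 : ∀ n, ¬ a ≤ n → coeff n (monomial a (1 : K) * g) = 0 := fun n h => by
      rw [coeff_monomial_mul, if_neg h]
    have hmem1 : monomial a (1 : K) * g ∈
        Ideal.span ((fun a => monomial a (1 : K)) '' (↑(insert a A) : Set (σ →₀ ℕ))) :=
      Ideal.mul_mem_right _ _
        (Ideal.subset_span ⟨a, Finset.mem_coe.mpr (Finset.mem_insert_self a A), rfl⟩)
    have hmem2 : f - monomial a (1 : K) * g ∈
        Ideal.span ((fun a => monomial a (1 : K)) '' (↑A : Set (σ →₀ ℕ))) := by
      refine ih fun n hn => ?_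
      rw [map_sub] at hn
      by_cases h : a ≤ n
      · rw [h1 n h, sub_self] at hn
        exact absurd rfl hn
      · rw [h2 n h, sub_zero] at hn
        obtain ⟨a', ha', hle⟩ := hf n hn
        rcases Finset.mem_insert.mp ha' with rfl | ha'
        · exact absurd hle h
        · exact ⟨a', ha', hle⟩
    have hmono : Ideal.span ((fun a => monomial a (1 : K)) '' (↑A : Set (σ →₀ ℕ))) ≤
        Ideal.span ((fun a => monomial a (1 : K)) '' (↑(insert a A) : Set (σ →₀ ℕ))) :=
      Ideal.span_mono (Set.image_mono (Finset.coe_subset.mpr (Finset.subset_insert a A)))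
    have h := add_mem hmem1 (hmono hmem2)
    rwa [add_sub_cancel] at h

/-- SUPPORT CRITERION: for finitely many generators, `f ∈ (X^a : a ∈ A)` iff every exponent in the
support of `f` is divisible by some generator. -/
theorem mem_span_monomial_iff (A : Finset (σ →₀ ℕ)) (f : MvPowerSeries σ K) :
    f ∈ Ideal.span ((fun a => monomial a (1 : K)) '' (A : Set (σ →₀ ℕ))) ↔
      ∀ n, coeff n f ≠ 0 → ∃ a ∈ A, a ≤ n := by
  refine ⟨fun hf n hn => ?_, mem_span_monomial_of_coeff A⟩
  by_contra h
  push Not at h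
  exact hn (coeff_eq_zero_of_mem_span_monomial hf h)

/-- The support criterion for a finite set of generators given as a `Set`. -/
theorem mem_span_monomial_iff_of_finite {A : Set (σ →₀ ℕ)} (hA : A.Finite) (f : MvPowerSeries σ K) :
    f ∈ Ideal.span ((fun a => monomial a (1 : K)) '' A) ↔ ∀ n, coeff n f ≠ 0 → ∃ a ∈ A, a ≤ n := by
  have h := mem_span_monomial_iff (K := K) hA.toFinset f
  simp only [Set.Finite.coe_toFinset, Set.Finite.mem_toFinset] at h
  exact h

/-- Membership in a monomial ideal only depends on the support: if every exponent of `g` is an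
exponent of `f ∈ (X^a : a ∈ A)`, then `g ∈ (X^a : a ∈ A)`. -/
theorem mem_span_monomial_of_support_subset (A : Finset (σ →₀ ℕ)) {f g : MvPowerSeries σ K}
    (hf : f ∈ Ideal.span ((fun a => monomial a (1 : K)) '' (A : Set (σ →₀ ℕ))))
    (hfg : ∀ n, coeff n g ≠ 0 → coeff n f ≠ 0) :
    g ∈ Ideal.span ((fun a => monomial a (1 : K)) '' (A : Set (σ →₀ ℕ))) := by
  rw [mem_span_monomial_iff] at hf ⊢
  exact fun n hn => hf n (hfg n hn)

/-! ## Monomial ideals are `p`-class graded -/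

/-- Each `p`-class component of a member of a (finitely generated) monomial ideal lies in it. -/
theorem pClassComponent_mem_span_monomial (A : Finset (σ →₀ ℕ)) {f : MvPowerSeries σ K}
    (hf : f ∈ Ideal.span ((fun a => monomial a (1 : K)) '' (A : Set (σ →₀ ℕ)))) (p : ℕ)
    (κ : σ → ZMod p) :
    pClassComponent p κ f ∈ Ideal.span ((fun a => monomial a (1 : K)) '' (A : Set (σ →₀ ℕ))) := by
  refine mem_span_monomial_of_support_subset A hf fun n hn h => hn ?_
  rw [coeff_pClassComponent]
  split_ifs
  · exact h
  · rfl

/-- `Set.Finite` form of `pClassComponent_mem_span_monomial`. -/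
theorem pClassComponent_mem_span_monomial_of_finite {A : Set (σ →₀ ℕ)} (hA : A.Finite)
    {f : MvPowerSeries σ K} (hf : f ∈ Ideal.span ((fun a => monomial a (1 : K)) '' A)) (p : ℕ)
    (κ : σ → ZMod p) : pClassComponent p κ f ∈ Ideal.span ((fun a => monomial a (1 : K)) '' A) := by
  have h := pClassComponent_mem_span_monomial (K := K) hA.toFinset (f := f)
  simp only [Set.Finite.coe_toFinset] at h
  exact h hf p κ

/-- If every `p`-class component of `f` lies in an ideal `I`, so does `f` (finitely many variables). -/
theorem mem_of_forall_pClassComponent_mem [Fintype σ] [DecidableEq σ] (p : ℕ) [NeZero p]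
    (I : Ideal (MvPowerSeries σ K)) {f : MvPowerSeries σ K}
    (h : ∀ κ : σ → ZMod p, pClassComponent p κ f ∈ I) : f ∈ I := by
  rw [← sum_pClassComponent p f]
  exact Ideal.sum_mem _ fun κ _ => h κ

/-- MONOMIAL IDEALS ARE `p`-CLASS GRADED: `f ∈ (X^a : a ∈ A)` iff all its class components are. -/
theorem mem_span_monomial_iff_forall_pClassComponent_mem [Fintype σ] [DecidableEq σ] (p : ℕ)
    [NeZero p] (A : Finset (σ →₀ ℕ)) (f : MvPowerSeries σ K) :
    f ∈ Ideal.span ((fun a => monomial a (1 : K)) '' (A : Set (σ →₀ ℕ))) ↔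
      ∀ κ : σ → ZMod p,
        pClassComponent p κ f ∈ Ideal.span ((fun a => monomial a (1 : K)) '' (A : Set (σ →₀ ℕ))) :=
  ⟨fun hf κ => pClassComponent_mem_span_monomial A hf p κ, mem_of_forall_pClassComponent_mem p _⟩

/-! ## The weight filtration is `p`-class graded -/

/-- A class component has weighted order at least that of the series. -/
theorem le_weightedOrder_pClassComponent (w : σ → ℕ) (p : ℕ) (κ : σ → ZMod p)
    (f : MvPowerSeries σ K) : f.weightedOrder w ≤ (pClassComponent p κ f).weightedOrder w := by
  refine le_weightedOrder w fun d hd => ?_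
  rw [coeff_pClassComponent]
  split_ifs
  · exact coeff_eq_zero_of_lt_weightedOrder w hd
  · rfl

/-- If all class components have weighted order `≥ n`, so does the series. -/
theorem le_weightedOrder_of_forall_pClassComponent [Fintype σ] [DecidableEq σ] (p : ℕ) [NeZero p]
    (w : σ → ℕ) {n : ℕ∞} {f : MvPowerSeries σ K}
    (h : ∀ κ : σ → ZMod p, n ≤ (pClassComponent p κ f).weightedOrder w) : n ≤ f.weightedOrder w := by
  refine le_weightedOrder w fun d hd => ?_
  rw [← sum_pClassComponent p f, map_sum]
  exact Finset.sum_eq_zero fun κ _ => coeff_eq_zero_of_lt_weightedOrder w (hd.trans_le (h κ))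

/-- THE WEIGHT FILTRATION IS `p`-CLASS GRADED: `W(f) ≥ n` iff `W(f_κ) ≥ n` for every class `κ`. -/
theorem le_weightedOrder_iff_forall_pClassComponent [Fintype σ] [DecidableEq σ] (p : ℕ) [NeZero p]
    (w : σ → ℕ) (n : ℕ∞) (f : MvPowerSeries σ K) :
    n ≤ f.weightedOrder w ↔ ∀ κ : σ → ZMod p, n ≤ (pClassComponent p κ f).weightedOrder w :=
  ⟨fun h κ => h.trans (le_weightedOrder_pClassComponent w p κ f),
    le_weightedOrder_of_forall_pClassComponent p w⟩

/-- The weighted order of a series is the minimum of the weighted orders of its class components. -/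
theorem weightedOrder_eq_iInf_pClassComponent [Fintype σ] [DecidableEq σ] (p : ℕ) [NeZero p]
    (w : σ → ℕ) (f : MvPowerSeries σ K) :
    f.weightedOrder w = ⨅ κ : σ → ZMod p, (pClassComponent p κ f).weightedOrder w :=
  le_antisymm (le_iInf fun κ => le_weightedOrder_pClassComponent w p κ f)
    (le_weightedOrder_of_forall_pClassComponent p w fun κ => iInf_le _ κ)

/-- A class component of weighted order exactly `W(f)` exists (finitely many variables, `p ≠ 0`). -/
theorem exists_weightedOrder_pClassComponent_eq [Fintype σ] [DecidableEq σ] (p : ℕ) [NeZero p]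
    (w : σ → ℕ) (f : MvPowerSeries σ K) :
    ∃ κ : σ → ZMod p, (pClassComponent p κ f).weightedOrder w = f.weightedOrder w := by
  obtain ⟨κ, hκ⟩ := exists_eq_ciInf_of_finite (f := fun κ : σ → ZMod p =>
    (pClassComponent p κ f).weightedOrder w)
  exact ⟨κ, by rw [hκ, weightedOrder_eq_iInf_pClassComponent p w f]⟩

/-- Coefficients of weight `W(f)` live in the class components of minimal weighted order: if
`W(f_κ) > W(f)` then `f` has no exponent of class `κ` and weight `W(f)`. -/
theorem coeff_eq_zero_of_weightedOrder_lt (w : σ → ℕ) (p : ℕ) (κ : σ → ZMod p)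
    {f : MvPowerSeries σ K} {d : σ →₀ ℕ} (hκ : exponentClass p d = κ)
    (hd : (Finsupp.weight w d : ℕ∞) < (pClassComponent p κ f).weightedOrder w) : coeff d f = 0 := by
  rw [← coeff_pClassComponent_of_eq hκ]
  exact coeff_eq_zero_of_lt_weightedOrder w hd

end Summit.ResolutionOfSingularities.ResolutionOfSingularities.Theorems.LocalEngine.Iota3.PClass
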